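import Mathlib
import HarnessLib
import Summits.NavierStokesRegularity.FluidComputer.TriggeredTransfer

/-!
# The amplitude ledger of a one-shot triggered-transfer scheme: admissible seeds `ε = e^{-aU/ν}`, one RUN of
# the machine under `Transfers ν`, and the geometric climb `U_n ≥ (ηλ)^{n/2} U_0 → ∞` of its level amplitudes

Cell `ns-blowup`, seat `ns-blowup-fc-prover-1` (D-0074 GROUP C «bridge support», door N1-FC); companion of
`TriggeredTransfer.lean` (ns-blowup-fc-route g0; the N1-FC door vocabulary `TriggerScheme`, `IsTrigger`,
`Step`, `Transfers`) and of the uniform-ratio ledger `GadgetLedger.lean` (this seat). LABEL: E–C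
bookkeeping. WHAT THIS IS NOT: not Navier–Stokes evidence and not a construction — every theorem below is
an implication from the OPEN predicate `TriggerScheme.Transfers ν` (never asserted anywhere) or plain real
arithmetic; no instance of any scheme is claimed.

The FC-AUDIT bookkeeping `Re_{k+1} = (ηλ)^{1/2} Re_k` (one child; KILLSHEET §VI.3) is, on a trigger scheme,
the clause `U' ≥ growth · U` of `TriggerScheme.Step` with `growth = (ηλ)^{1/2} > 1`
(`TriggerScheme.one_lt_growth`, the Kelvin-critical floor `1 < ηλ`). This file turns it into the ledger a
cascade proof consumes:

* `growth_pos`, `growth_sq` (`growth² = ηλ`), `one_le_growth`;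
* AMPLITUDE CHAINS: if `growth · U_n ≤ U_{n+1}` for all `n` then `U_0 · growthⁿ ≤ U_n` (`mul_pow_le_of_chain`),
  the amplitudes never drop below the threshold (`UStar_le_of_chain`) and tend to infinity
  (`tendsto_atTop_of_chain`) — the level Reynolds numbers CLIMB geometrically, as the floor demands;
* THE CANONICAL ADMISSIBLE SEED at viscosity `ν > 0` and amplitude `U > 0`: `ε = exp (-(a U / ν))` is in
  `(0, 1]` and saturates the admissibility budget `ν |log ε| = a U` (`seed_pos`, `seed_le_one`,
  `seed_admissible`) — the smallest trigger the e-fold budget allows;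
* ONE RUN OF THE MACHINE (`exists_run`): if `𝒮.Transfers ν` (`ν > 0`), then from every member `w₀ ∈ F U₀`,
  `U₀ ≥ U⋆`, there are sequences `U : ℕ → ℝ`, `w : ℕ → Vel` with `U 0 = U₀`, `w 0 = w₀`, `w n ∈ F (U n)`,
  `U⋆ ≤ U n`, `growth · U n ≤ U (n+1)` and, at every level, one triggered transfer
  `𝒮.Step ν (U n) (exp (-(a · U n / ν))) (w n)` handing `w n` over to (a zoomed copy of) `w (n+1)`;
  consequently `U n ≥ U₀ · growthⁿ → ∞` (`exists_run_tendsto`). This is the countable chain the gluing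
  argument (closing the door on `BreakdownWitness`) starts from; the gluing itself — parabolic zooms,
  unforced overlaps, smoothness of the summed force through the blow-up time — is NOT done here.

References: T. Tao, J. Amer. Math. Soc. 29 (2016) §1.3 (machine paradigm; the clock and the trigger);
the cell's KILLSHEET §VI.3 (FC-AUDIT). 0 sorry; axioms ⊆ {propext, Classical.choice, Quot.sound}.
-/

noncomputable section

namespace Summit.NavierStokesRegularity.FluidComputer.TriggeredTransfer.TriggerScheme

open Set Filter Function
open scoped Topology
open Literature.Analysis.FluidPDE
open Literature.Analysis.FluidPDE.FluidComputer (E3 Vel)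

variable (𝒮 : TriggerScheme)

/-! ## The growth factor -/

/-- The growth factor `(ηλ)^{1/2}` is positive. -/
theorem growth_pos : 0 < 𝒮.growth := lt_trans one_pos 𝒮.one_lt_growth

/-- `1 ≤ growth`. -/
theorem one_le_growth : 1 ≤ 𝒮.growth := 𝒮.one_lt_growth.le

/-- `growth² = η λ` (the squared amplitude ratio is the energy-times-scale ratio of the ledger). -/
theorem growth_sq : 𝒮.growth ^ 2 = 𝒮.eta * 𝒮.lam := by
  unfold growth
  exact Real.sq_sqrt (le_trans zero_le_one 𝒮.kelvin.le)

/-! ## Amplitude chains climb geometrically -/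

/-- Along a chain `growth · U_n ≤ U_{n+1}`: `U_0 · growthⁿ ≤ U_n` (only `growth ≥ 0` is used). -/
theorem mul_pow_le_of_chain {U : ℕ → ℝ} (hU : ∀ n, 𝒮.growth * U n ≤ U (n + 1)) (n : ℕ) :
    U 0 * 𝒮.growth ^ n ≤ U n := by
  induction n with
  | zero => simp
  | succ n ih =>
    calc U 0 * 𝒮.growth ^ (n + 1) = 𝒮.growth * (U 0 * 𝒮.growth ^ n) := by rw [pow_succ]; ring
      _ ≤ 𝒮.growth * U n := mul_le_mul_of_nonneg_left ih 𝒮.growth_pos.le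
      _ ≤ U (n + 1) := hU n

/-- Along a chain the amplitudes are non-decreasing: `U_n ≤ U_{n+1}` (as `growth ≥ 1`, `U_n ≥ 0`). -/
theorem le_succ_of_chain {U : ℕ → ℝ} (hU : ∀ n, 𝒮.growth * U n ≤ U (n + 1)) {n : ℕ} (hn : 0 ≤ U n) :
    U n ≤ U (n + 1) :=
  le_trans (le_mul_of_one_le_left hn 𝒮.one_le_growth) (hU n)

/-- Along a chain started at or above the threshold, every amplitude is at or above the threshold. -/
theorem UStar_le_of_chain {U : ℕ → ℝ} (hU : ∀ n, 𝒮.growth * U n ≤ U (n + 1)) (h0 : 𝒮.UStar ≤ U 0)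
    (n : ℕ) : 𝒮.UStar ≤ U n := by
  induction n with
  | zero => exact h0
  | succ n ih => exact ih.trans (𝒮.le_succ_of_chain hU (𝒮.UStar_pos.le.trans ih))

/-- Along a chain started at a positive amplitude the amplitudes tend to infinity (`growth > 1`). -/
theorem tendsto_atTop_of_chain {U : ℕ → ℝ} (hU : ∀ n, 𝒮.growth * U n ≤ U (n + 1)) (h0 : 0 < U 0) :
    Tendsto U atTop atTop := by
  have hgeo : Tendsto (fun n => U 0 * 𝒮.growth ^ n) atTop atTop :=
    (tendsto_pow_atTop_atTop_of_one_lt 𝒮.one_lt_growth).const_mul_atTop h0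
  exact tendsto_atTop_mono (fun n => 𝒮.mul_pow_le_of_chain hU n) hgeo

/-! ## The canonical admissible seed -/

/-- The canonical seed `ε = exp (-(a U / ν))` is positive. -/
theorem seed_pos (ν U : ℝ) : 0 < Real.exp (-(𝒮.a * U / ν)) := Real.exp_pos _

/-- The canonical seed is at most `1` for `ν > 0`, `U ≥ 0`. -/
theorem seed_le_one {ν U : ℝ} (hν : 0 < ν) (hU : 0 ≤ U) : Real.exp (-(𝒮.a * U / ν)) ≤ 1 := by
  rw [Real.exp_le_one_iff, neg_nonpos]
  exact div_nonneg (mul_nonneg 𝒮.a_pos.le hU) hν.le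

/-- The canonical seed SATURATES the admissibility budget: `ν |log ε| = a U` (`ν > 0`, `U ≥ 0`); in
particular it is admissible, `ν |log ε| ≤ a U`. -/
theorem seed_admissible {ν U : ℝ} (hν : 0 < ν) (hU : 0 ≤ U) :
    ν * |Real.log (Real.exp (-(𝒮.a * U / ν)))| ≤ 𝒮.a * U := by
  rw [Real.log_exp, abs_neg, abs_of_nonneg (div_nonneg (mul_nonneg 𝒮.a_pos.le hU) hν.le),
    mul_div_cancel₀ _ hν.ne']

/-! ## One run of the machine -/

/-- One step of the run: under `Transfers ν` (`ν > 0`), from a member `w ∈ F U` with `U ≥ U⋆` the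
canonical seed fires one triggered transfer, whose hand-over state is a member one amplitude level up
(`U' ≥ growth · U ≥ U⋆`). -/
theorem exists_next {ν : ℝ} (hν : 0 < ν) (hT : 𝒮.Transfers ν) {U : ℝ} (hU : 𝒮.UStar ≤ U) {w : Vel}
    (hw : w ∈ 𝒮.F U) :
    ∃ (U' : ℝ) (w' : Vel), 𝒮.growth * U ≤ U' ∧ 𝒮.UStar ≤ U' ∧ w' ∈ 𝒮.F U' ∧
      𝒮.Step ν U (Real.exp (-(𝒮.a * U / ν))) w := by
  have hU0 : 0 ≤ U := 𝒮.UStar_pos.le.trans hU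
  have hstep : 𝒮.Step ν U (Real.exp (-(𝒮.a * U / ν))) w :=
    hT U hU w hw _ (𝒮.seed_pos ν U) (𝒮.seed_le_one hν hU0) (𝒮.seed_admissible hν hU0)
  obtain ⟨T, δ, g, u, p, -, -, -, -, -, -, -, U', w', x₀, hgrow, hw', -, -⟩ := id hstep
  refine ⟨U', w', hgrow, ?_, hw', hstep⟩
  exact hU.trans (le_trans (le_mul_of_one_le_left hU0 𝒮.one_le_growth) hgrow)

/-- **ONE RUN OF THE MACHINE.** If the scheme transfers at viscosity `ν > 0`, then from every member
`w₀ ∈ F U₀` at amplitude `U₀ ≥ U⋆` there is an infinite chain of level states `w n ∈ F (U n)`,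
`U 0 = U₀`, `w 0 = w₀`, all above threshold, with amplitudes climbing by the factor `growth = (ηλ)^{1/2}`
per level, each handed to the next by one triggered transfer fired with the canonical admissible seed
`exp (-(a · U n / ν))`. (Countable dependent choice along `exists_next`.) -/
theorem exists_run {ν : ℝ} (hν : 0 < ν) (hT : 𝒮.Transfers ν) {U₀ : ℝ} (hU₀ : 𝒮.UStar ≤ U₀) {w₀ : Vel}
    (hw₀ : w₀ ∈ 𝒮.F U₀) :
    ∃ (U : ℕ → ℝ) (w : ℕ → Vel), U 0 = U₀ ∧ w 0 = w₀ ∧ (∀ n, 𝒮.UStar ≤ U n) ∧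
      (∀ n, w n ∈ 𝒮.F (U n)) ∧ (∀ n, 𝒮.growth * U n ≤ U (n + 1)) ∧
      ∀ n, 𝒮.Step ν (U n) (Real.exp (-(𝒮.a * U n / ν))) (w n) := by
  classical
  -- admissible states and the successor map chosen along `exists_next`
  let X := {q : ℝ × Vel // 𝒮.UStar ≤ q.1 ∧ q.2 ∈ 𝒮.F q.1}
  have hnext : ∀ q : X, ∃ q' : X, 𝒮.growth * q.1.1 ≤ q'.1.1 ∧
      𝒮.Step ν q.1.1 (Real.exp (-(𝒮.a * q.1.1 / ν))) q.1.2 := by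
    intro q
    obtain ⟨U', w', hgrow, hU', hw', hstep⟩ := 𝒮.exists_next hν hT q.2.1 q.2.2
    exact ⟨⟨(U', w'), hU', hw'⟩, hgrow, hstep⟩
  choose f hf using hnext
  let q₀ : X := ⟨(U₀, w₀), hU₀, hw₀⟩
  let s : ℕ → X := fun n => f^[n] q₀
  have hs : ∀ n, s (n + 1) = f (s n) := fun n => Function.iterate_succ_apply' f n q₀
  refine ⟨fun n => (s n).1.1, fun n => (s n).1.2, rfl, rfl, fun n => (s n).2.1, fun n => (s n).2.2,
    fun n => ?_, fun n => (hf (s n)).2⟩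
  show 𝒮.growth * (s n).1.1 ≤ (s (n + 1)).1.1
  rw [hs n]
  exact (hf (s n)).1

/-- **The run's amplitudes climb to infinity**: `U n ≥ U₀ · growthⁿ` and `U n → ∞` — the level Reynolds
numbers of a transferring scheme grow geometrically (`Re_{k+1} ≥ (ηλ)^{1/2} Re_k`, the FC-AUDIT floor
`ηλ > 1` in action). -/
theorem exists_run_tendsto {ν : ℝ} (hν : 0 < ν) (hT : 𝒮.Transfers ν) {U₀ : ℝ} (hU₀ : 𝒮.UStar ≤ U₀)
    {w₀ : Vel} (hw₀ : w₀ ∈ 𝒮.F U₀) :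
    ∃ (U : ℕ → ℝ) (w : ℕ → Vel), U 0 = U₀ ∧ w 0 = w₀ ∧ (∀ n, w n ∈ 𝒮.F (U n)) ∧
      (∀ n, 𝒮.Step ν (U n) (Real.exp (-(𝒮.a * U n / ν))) (w n)) ∧
      (∀ n, U₀ * 𝒮.growth ^ n ≤ U n) ∧ Tendsto U atTop atTop := by
  obtain ⟨U, w, hU0, hw0, -, hmem, hchain, hstep⟩ := 𝒮.exists_run hν hT hU₀ hw₀
  have hpos : 0 < U 0 := by rw [hU0]; exact 𝒮.UStar_pos.trans_le hU₀
  refine ⟨U, w, hU0, hw0, hmem, hstep, fun n => ?_, 𝒮.tendsto_atTop_of_chain hchain hpos⟩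
  rw [← hU0]
  exact 𝒮.mul_pow_le_of_chain hchain n

/-- The seed exists at SOME level (the scheme's `seed` axiom), so a transferring scheme always has a run:
amplitudes `U n → ∞` realised by members `w n ∈ F (U n)` linked by triggered transfers. -/
theorem exists_run_of_seed {ν : ℝ} (hν : 0 < ν) (hT : 𝒮.Transfers ν) :
    ∃ (U : ℕ → ℝ) (w : ℕ → Vel), (∀ n, w n ∈ 𝒮.F (U n)) ∧
      (∀ n, 𝒮.Step ν (U n) (Real.exp (-(𝒮.a * U n / ν))) (w n)) ∧ Tendsto U atTop atTop := by
  obtain ⟨U₀, hU₀, w₀, hw₀⟩ := 𝒮.seed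
  obtain ⟨U, w, -, -, hmem, hstep, -, htend⟩ := 𝒮.exists_run_tendsto hν hT hU₀ hw₀
  exact ⟨U, w, hmem, hstep, htend⟩

end Summit.NavierStokesRegularity.FluidComputer.TriggeredTransfer.TriggerScheme

end
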